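import Summits.ABC.ABC.Theorems.IsogenyGlueCongruenceEllipticGluingPrimeBoundStubBigImageTorsionCoreAux5
import Literature.NumberTheory.EllipticCurves.KummerSelmerStructure
import Literature.NumberTheory.EllipticCurves.GaloisAction
import Literature.NumberTheory.GaloisRepresentations.AbsGaloisGroup
import HarnessLib

/-!
# Crux `EllipticGluingPrimeBound`, line SketchIdeator5 — stub `stub_endFieldAbelianPartnerBound`
# (the arithmetic shell of the endomorphism-field-abelian slice)

Stub `stub_endFieldAbelianPartnerBound` of line `SketchIdeator5` (slices of the free branch
`U_simple`) of crux U `Summit.ABC.ABC.Theses.IsogenyGlueCongruence.EllipticGluingPrimeBound`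
(item stmt-ABC-13919), registered signature (namespace `Summit.ABC.ABC.Theorems.GluingSlices`).

**Statement.** Assume the algebraic core (the registered neighbour
`stub_abelianKernelMinkowskiCore`, taken here as a hypothesis): a group `Γ` acting `ℤ`-linearly
with finite image on a lattice `H` and ONTO `Aut V`, `#V = ℓ²`, `ℓ V = 0`, `ℓ ≥ 5` prime, with the
kernel of the lattice action abelian on `V`, has `ℓ ≤ rank H + 1`.  Then for an elliptic curve
`W/ℚ` with surjective mod-`ℓ` representation (`ℓ ≥ 5`), an abelian variety `A/ℚ` such that any
two elements of `Γ_A = {σ ∈ Γ_ℚ | σ fixes every geometric endomorphism of A}` commute on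
`A[ℓ]`, and a `Γ_ℚ`-equivariant embedding `ι : W[ℓ] ↪ A(ℚ̄)`, we get `ℓ ≤ 4 (dim A)² + 1`.

**Proof.** Instantiate the core with `Γ = Γ_ℚ`, `H = End(A_ℚ̄)` carrying the representation
`σ ↦ galConj σ` (additive: `galConj_add`; a homomorphism: `galConj_one`, `galConj_mul`; finite
image: it factors through the finitely many ring automorphisms of
`AbelianVariety.finite_range_toRingHom_galois`; free of rank `≤ 4 dim A · dim A`:
`BigImage.homGaloisLattice A A`), `V = W[ℓ]` (`#W[ℓ] = ℓ²`: `WeierstrassCurve.natCard_geomTorsion`)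
with `π = ρ̄_{W,ℓ}` (`galoisRepTorsion`, surjective by hypothesis).  An element of the kernel fixes
every geometric endomorphism, so two of them commute on `A[ℓ] ⊇ ι(W[ℓ])`, hence on `W[ℓ]` by
equivariance and injectivity of `ι`.  The core gives `ℓ ≤ rank End(A_ℚ̄) + 1 ≤ 4 (dim A)² + 1`.
No named facts beyond the tree's proved theorems; no definitions.
-/

noncomputable section

-- `Summit.<Summit>.<Problem>` is the mandated summit-side namespace (CONVENTIONS §2); for the
-- single-conjunct summit `ABC` the two coincide, so the duplicate `ABC.ABC` is deliberate.
set_option linter.dupNamespace false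

namespace Summit.ABC.ABC.Theorems.GluingSlices

open CategoryTheory CategoryTheory.Limits AlgebraicGeometry
open Literature.AlgebraicGeometry.Motives
open Summit.ABC.ABC.Theorems.IsotypicMinkowski

/-- **Registered stub `stub_endFieldAbelianPartnerBound`** (the endomorphism-field-abelian slice of
`U_simple`, arithmetic shell over the algebraic core): for `W/ℚ` with surjective `ρ̄_{W,ℓ}`,
`ℓ ≥ 5`, and `A/ℚ` whose `ℓ`-torsion is acted on through pairwise commuting operators by the
elements of `Γ_ℚ` fixing all geometric endomorphisms of `A`, a `Γ_ℚ`-equivariant embedding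
`W[ℓ] ↪ A(ℚ̄)` forces `ℓ ≤ 4 (dim A)² + 1`. -/
theorem stub_endFieldAbelianPartnerBound :
    (∀ (ℓ : ℕ) [Fact ℓ.Prime], 5 ≤ ℓ →
      ∀ {Γ H V : Type} [Group Γ] [AddCommGroup H] [Module.Free ℤ H] [Module.Finite ℤ H]
        [AddCommGroup V], Nat.card V = ℓ ^ 2 → (∀ v : V, (ℓ : ℤ) • v = 0) →
        ∀ (ρ : Representation ℤ Γ H), (Set.range ρ).Finite →
        ∀ (π : Γ →* Multiplicative (AddAut V)), Function.Surjective π →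
        (∀ σ τ : Γ, ρ σ = 1 → ρ τ = 1 → π σ * π τ = π τ * π σ) →
          ℓ ≤ Module.finrank ℤ H + 1) →
    ∀ (W : WeierstrassCurve ℚ) [W.IsElliptic] (A : AbelianVariety.{0} ℚ) (ℓ : ℕ), ℓ.Prime → 5 ≤ ℓ →
      W.HasSurjectiveModNGaloisRep ℓ →
      (∀ σ τ : Field.absoluteGaloisGroup ℚ,
        (∀ r : A.baseChange (AlgebraicClosure ℚ) ⟶ A.baseChange (AlgebraicClosure ℚ),
          A.galConj (AlgebraicClosure ℚ) (Field.absoluteGaloisGroup.toAlgEquiv ℚ σ) r = r) →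
        (∀ r : A.baseChange (AlgebraicClosure ℚ) ⟶ A.baseChange (AlgebraicClosure ℚ),
          A.galConj (AlgebraicClosure ℚ) (Field.absoluteGaloisGroup.toAlgEquiv ℚ τ) r = r) →
        ∀ P ∈ A.geomTorsion ℓ, σ • τ • P = τ • σ • P) →
      (∃ ι : W.geomTorsion ℓ →+ A.geomPoints, Function.Injective ι ∧
        ∀ (σ : Field.absoluteGaloisGroup ℚ) (P : W.geomTorsion ℓ), ι (σ • P) = σ • ι P) →
      ℓ ≤ 4 * A.dim ^ 2 + 1 := by
  intro hcore W _ A ℓ hℓ h5 hsurj hab hι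
  haveI : Fact ℓ.Prime := ⟨hℓ⟩
  obtain ⟨ι, hιinj, hισ⟩ := hι
  -- the lattice `End(A_ℚ̄)`: free of finite rank `≤ 4 dim A · dim A`
  obtain ⟨hfree, hfinite, hrank, -⟩ := BigImage.homGaloisLattice A A
  haveI := hfree
  haveI := hfinite
  -- the Galois representation on `End(A_ℚ̄)` by `galConj`
  let θ (σ : Field.absoluteGaloisGroup ℚ) :
      (A.baseChange (AlgebraicClosure ℚ) ⟶ A.baseChange (AlgebraicClosure ℚ)) →ₗ[ℤ]
        (A.baseChange (AlgebraicClosure ℚ) ⟶ A.baseChange (AlgebraicClosure ℚ)) :=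
    (AddMonoidHom.mk'
      (fun r ↦ A.galConj (AlgebraicClosure ℚ) (Field.absoluteGaloisGroup.toAlgEquiv ℚ σ) r)
      (A.galConj_add (AlgebraicClosure ℚ) (Field.absoluteGaloisGroup.toAlgEquiv ℚ σ))).toIntLinearMap
  have θ_apply : ∀ σ r, θ σ r =
      A.galConj (AlgebraicClosure ℚ) (Field.absoluteGaloisGroup.toAlgEquiv ℚ σ) r := fun _ _ ↦ rfl
  let ρ : Representation ℤ (Field.absoluteGaloisGroup ℚ)
      (A.baseChange (AlgebraicClosure ℚ) ⟶ A.baseChange (AlgebraicClosure ℚ)) :=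
    { toFun := θ
      map_one' := by
        refine LinearMap.ext fun r ↦ ?_
        rw [θ_apply, map_one]
        exact A.galConj_one (AlgebraicClosure ℚ) r
      map_mul' := fun σ τ ↦ by
        refine LinearMap.ext fun r ↦ ?_
        rw [θ_apply, map_mul]
        exact A.galConj_mul (AlgebraicClosure ℚ) _ _ r }
  have ρ_apply : ∀ σ r, ρ σ r =
      A.galConj (AlgebraicClosure ℚ) (Field.absoluteGaloisGroup.toAlgEquiv ℚ σ) r := fun _ _ ↦ rfl
  -- finite image: `ρ σ` only depends on the ring automorphism `σ • ·` of `End(A_ℚ̄)`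
  have hfin : (Set.range ρ).Finite := by
    have hfin₀ := A.finite_range_toRingHom_galois (AbelianVariety.module_finite_hom_holds _ _)
      AbelianVariety.isTorsionFree_int_hom_of_charZero
    let Ψ : (End (A.baseChange (AlgebraicClosure ℚ)) →+* End (A.baseChange (AlgebraicClosure ℚ))) →
        ((A.baseChange (AlgebraicClosure ℚ) ⟶ A.baseChange (AlgebraicClosure ℚ)) →ₗ[ℤ]
          (A.baseChange (AlgebraicClosure ℚ) ⟶ A.baseChange (AlgebraicClosure ℚ))) := fun t ↦
      (AddMonoidHom.mk' (fun f ↦ End.asHom (t (End.of f))) (fun f g ↦ by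
        change t (End.of f + End.of g) = t (End.of f) + t (End.of g)
        rw [t.map_add])).toIntLinearMap
    refine (hfin₀.image Ψ).subset ?_
    rintro _ ⟨σ, rfl⟩
    refine ⟨MulSemiringAction.toRingHom (AlgebraicClosure ℚ ≃ₐ[ℚ] AlgebraicClosure ℚ)
        (End (A.baseChange (AlgebraicClosure ℚ))) (Field.absoluteGaloisGroup.toAlgEquiv ℚ σ),
      ⟨Field.absoluteGaloisGroup.toAlgEquiv ℚ σ, rfl⟩, ?_⟩
    refine LinearMap.ext fun f ↦ ?_
    rfl
  -- `V = W[ℓ]`: `#W[ℓ] = ℓ²`, `ℓ W[ℓ] = 0`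
  have hcard : Nat.card (W.geomTorsion ℓ) = ℓ ^ 2 := by
    rw [W.natCard_geomTorsion (ℓ : ℤ) (by exact_mod_cast hℓ.ne_zero), Int.natAbs_natCast]
  have htor : ∀ v : W.geomTorsion ℓ, (ℓ : ℤ) • v = 0 := fun v ↦ by
    rw [natCast_zsmul]
    exact AddSubgroup.torsionBy.nsmul v
  -- elements of the kernel commute on `W[ℓ]` (through `ι` and the hypothesis on `A[ℓ]`)
  have hcomm : ∀ σ τ : Field.absoluteGaloisGroup ℚ, ρ σ = 1 → ρ τ = 1 →
      W.galoisRepTorsion ℓ σ * W.galoisRepTorsion ℓ τ =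
        W.galoisRepTorsion ℓ τ * W.galoisRepTorsion ℓ σ := by
    intro σ τ hσ hτ
    have hσ' : ∀ r : A.baseChange (AlgebraicClosure ℚ) ⟶ A.baseChange (AlgebraicClosure ℚ),
        A.galConj (AlgebraicClosure ℚ) (Field.absoluteGaloisGroup.toAlgEquiv ℚ σ) r = r :=
      fun r ↦ by rw [← ρ_apply, hσ]; rfl
    have hτ' : ∀ r : A.baseChange (AlgebraicClosure ℚ) ⟶ A.baseChange (AlgebraicClosure ℚ),
        A.galConj (AlgebraicClosure ℚ) (Field.absoluteGaloisGroup.toAlgEquiv ℚ τ) r = r :=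
      fun r ↦ by rw [← ρ_apply, hτ]; rfl
    have hc := hab σ τ hσ' hτ'
    apply Multiplicative.toAdd.injective
    rw [toAdd_mul, toAdd_mul]
    refine AddEquiv.ext fun v ↦ ?_
    rw [AddAut.add_apply, AddAut.add_apply, WeierstrassCurve.galoisRepTorsion_apply,
      WeierstrassCurve.galoisRepTorsion_apply, WeierstrassCurve.galoisRepTorsion_apply,
      WeierstrassCurve.galoisRepTorsion_apply]
    apply hιinj
    have hmem : ι v ∈ A.geomTorsion ℓ := by
      rw [AbelianVariety.mem_geomTorsion_iff', ← map_zsmul, htor v, map_zero]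
    rw [hισ, hισ, hισ, hισ]
    exact hc (ι v) hmem
  -- the core
  have key := hcore ℓ h5 hcard htor ρ hfin (W.galoisRepTorsion ℓ) hsurj hcomm
  have hsq : A.dim ^ 2 = A.dim * A.dim := sq A.dim
  rw [hsq]
  calc ℓ ≤ Module.finrank ℤ (A.baseChange (AlgebraicClosure ℚ) ⟶ A.baseChange (AlgebraicClosure ℚ))
        + 1 := key
    _ ≤ 4 * A.dim * A.dim + 1 := by omega
    _ = 4 * (A.dim * A.dim) + 1 := by ring

end Summit.ABC.ABC.Theorems.GluingSlices

end
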